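import Summits.QuantumFields.QCD.Theorems.SpectralDefectExtinctionWegnerEstimateCoareaCircleShape

/-!
# Bridge lemma D toward stub `coareaWegner` of line `Sketch` (skeleton "ResolventCell", gen 2) for
crux `SpectralDefectExtinction.WegnerEstimate` (item stmt-QuantumFields-8966):
one-link modifications are rank-`24` perturbations; level crossings have multiplicity `≤ 24`

The crossing count "`≤ 2r = 48` zeros of `t ↦ det (H(t) − E)` along a one-link circle"
(`hzero` = the landed `stub_circleZeroCount`, fed by bridge lemma B
`coareaWegner_oneLinkCircle_detShape`) counts DISTINCT parameters `t`.  The level-set measure /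
Banach indicatrix of the paper proof (Lines/Sketch.md §gen 2) counts crossings of ALL eigenvalue
branches, i.e. each `t` with the multiplicity of `E` in `spec H(t)`, which a priori could be as large
as `12 L⁴`.  This file supplies the missing uniform bound: changing ONE link of the gauge field changes
`H = Γ₅ D_W(·, m₀, 1)` by a matrix of rank `≤ 24` (`coareaWegner_oneLink_rank_le`; it is
`B_q · diag(k, kᴴ) · C_q` through the `12 ⊕ 12` colour–spin coordinates at the two endpoints of the
link, bridge lemma B's factorization), hence if `H(W[e ↦ v']) − S` is invertible for SOME value `v'`
of the link then `dim ker (H(W[e ↦ v]) − S) ≤ 24` for EVERY value `v`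
(`coareaWegner_oneLink_finrank_ker_le`, from the general `coareaWegner_finrank_ker_add_le_rank`:
`dim ker (A + R) ≤ rank R` for invertible `A`), and in particular every non-flat level `E` (one with
`det (H(W[e ↦ v']) − E) ≠ 0` for some `v'`) is an eigenvalue of multiplicity `≤ 24` of every
`H(W[e ↦ v])` (`coareaWegner_oneLink_eigenvalue_mult_le`, multiplicity counted in Mathlib's
`IsHermitian.eigenvalues`, the spectral data of hypothesis `hspec`).  So along a one-link circle a
non-flat level is crossed at most `48 · 24` times counted with multiplicity, uniformly in `L`.
-/

noncomputable section

namespace Summit.QuantumFields.QCD.Cruxes.WegnerEstimate.ResolventCell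

open MeasureTheory
open scoped Matrix BigOperators
open Literature.MathematicalPhysics.QuantumLattice Literature.MathematicalPhysics.QuantumFieldTheory
  Literature.Probability.LatticeModels
open Matrix
open scoped ComplexOrder

/-- **Kernel of an invertible matrix plus a perturbation.**  If `A` is invertible then
`dim ker (A + R) ≤ rank R`: on `ker (A + R)` one has `A v = R (−v)`, so `v ↦ A v` embeds the kernel
into the range of `R`. -/
theorem coareaWegner_finrank_ker_add_le_rank {n : Type*} [Fintype n] [DecidableEq n]
    (A R : Matrix n n ℂ) (hA : A.det ≠ 0) :
    Module.finrank ℂ (LinearMap.ker (A + R).mulVecLin) ≤ R.rank := by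
  have hAu : IsUnit A := (Matrix.isUnit_iff_isUnit_det A).2 (isUnit_iff_ne_zero.2 hA)
  set e : (n → ℂ) ≃ₗ[ℂ] (n → ℂ) := A.toLinearEquiv' hAu.invertible with he
  have heA : ∀ v, e v = A *ᵥ v := fun v => by
    change ((A.toLinearEquiv' hAu.invertible : Module.End ℂ (n → ℂ))) v = A *ᵥ v
    rw [Matrix.toLinearEquiv'_apply, Matrix.toLin'_apply]
  have hle : (LinearMap.ker (A + R).mulVecLin).map (e : (n → ℂ) →ₗ[ℂ] (n → ℂ)) ≤
      LinearMap.range R.mulVecLin := by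
    rintro _ ⟨v, hv, rfl⟩
    rw [SetLike.mem_coe, LinearMap.mem_ker, Matrix.mulVecLin_apply, Matrix.add_mulVec] at hv
    refine ⟨-v, ?_⟩
    rw [Matrix.mulVecLin_apply, Matrix.mulVec_neg, LinearEquiv.coe_coe, heA]
    exact (eq_neg_of_add_eq_zero_left hv).symm
  calc Module.finrank ℂ (LinearMap.ker (A + R).mulVecLin)
      = Module.finrank ℂ ((LinearMap.ker (A + R).mulVecLin).map (e : (n → ℂ) →ₗ[ℂ] (n → ℂ))) :=
        (LinearEquiv.finrank_map_eq e _).symm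
    _ ≤ Module.finrank ℂ (LinearMap.range R.mulVecLin) := Submodule.finrank_mono hle
    _ = R.rank := rfl

/-- **Multiplicity versus kernel dimension.**  For a Hermitian matrix `H` and a real level `E`, the
number of indices `j` with `hH.eigenvalues j = E` is at most `dim ker (H − E·1)` (the corresponding
vectors of the orthonormal eigenvector basis are linearly independent and lie in that kernel). -/
theorem coareaWegner_card_eigenvalues_eq_le_finrank_ker {n : Type*} [Fintype n] [DecidableEq n]
    {H : Matrix n n ℂ} (hH : H.IsHermitian) (E : ℝ) :
    Fintype.card {j // hH.eigenvalues j = E} ≤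
      Module.finrank ℂ (LinearMap.ker (H - ((E : ℝ) : ℂ) • (1 : Matrix n n ℂ)).mulVecLin) := by
  set K := LinearMap.ker (H - ((E : ℝ) : ℂ) • (1 : Matrix n n ℂ)).mulVecLin with hK
  have hmem : ∀ j : {j // hH.eigenvalues j = E}, (⇑(hH.eigenvectorBasis j.1) : n → ℂ) ∈ K := by
    intro j
    rw [hK, LinearMap.mem_ker, Matrix.mulVecLin_apply, Matrix.sub_mulVec, Matrix.smul_mulVec,
      Matrix.one_mulVec, hH.mulVec_eigenvectorBasis, j.2, sub_eq_zero]
    rfl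
  -- the whole eigenvector basis, read in `n → ℂ`, is linearly independent
  have hli : LinearIndependent ℂ (fun j : n => (⇑(hH.eigenvectorBasis j) : n → ℂ)) := by
    have h := hH.eigenvectorBasis.toBasis.linearIndependent.map'
      ((WithLp.linearEquiv 2 ℂ (n → ℂ) : EuclideanSpace ℂ n →ₗ[ℂ] (n → ℂ))) (LinearEquiv.ker _)
    simpa [Function.comp_def, OrthonormalBasis.coe_toBasis] using h
  -- restricted to the level `E` and corestricted to the kernel
  have hli' : LinearIndependent ℂ (fun j : {j // hH.eigenvalues j = E} =>
      (⟨(⇑(hH.eigenvectorBasis j.1) : n → ℂ), hmem j⟩ : K)) := by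
    apply LinearIndependent.of_comp K.subtype
    exact hli.comp (fun j : {j // hH.eigenvalues j = E} => j.1) Subtype.val_injective
  exact hli'.fintype_card_le_finrank

/-- **One-link modifications of `Γ₅ D_W` have rank `≤ 24`.**  For any gauge field `W`, link
`e = (z, μ)` and two values `v, v'` of that link,
`rank (H(W[e ↦ v]) − H(W[e ↦ v'])) ≤ 24`, `H = Γ₅ D_W(·, m₀, 1)`: the difference is supported on the
two `12 × 12` colour–spin blocks at `(z, z + μ̂)` and `(z + μ̂, z)` and factors through the
`12 ⊕ 12` coordinates there (bridge lemma B's `coareaWegner_block_factor`).  All `L ≥ 1`. -/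
theorem coareaWegner_oneLink_rank_le {L : ℕ} [NeZero L] (W : GaugeConfig 4 L SU3) (m₀ : ℝ)
    (z : TorusSite 4 L) (μ : Fin 4) (v v' : SU3) :
    (spinorLift gammaFive * wilsonDirac (fundamentalRep (Fin 3)) (Function.update W (z, μ) v) m₀ 1 -
      spinorLift gammaFive * wilsonDirac (fundamentalRep (Fin 3)) (Function.update W (z, μ) v') m₀ 1).rank
      ≤ 24 := by
  -- the `12 × 12` colour–spin hop block of a `3 × 3` colour matrix `M`
  set k : Matrix (Fin 3) (Fin 3) ℂ → Matrix (Fin 3 × Fin 4) (Fin 3 × Fin 4) ℂ := fun M =>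
    Matrix.of fun i j : Fin 3 × Fin 4 => -(1 / 2 : ℂ) * ((![1, 1, -1, -1] : Fin 4 → ℂ) i.2 *
      (((1 : ℝ) : ℂ) • (1 : Matrix (Fin 4) (Fin 4) ℂ) - euclideanGamma μ) i.2 j.2 * M i.1 j.1) with hk
  -- the forward-hop matrix of the edge `e'` with colour matrix `M`
  set Fe : Edge 4 L → Matrix (Fin 3) (Fin 3) ℂ → Matrix (QuarkIdx L) (QuarkIdx L) ℂ := fun e' M =>
    Matrix.of fun p q : QuarkIdx L =>
      if p.1 = e'.1 ∧ q.1 = Literature.MathematicalPhysics.QuantumFieldTheory.Site.shift e'.1 e'.2 then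
        -(1 / 2 : ℂ) * ((![1, 1, -1, -1] : Fin 4 → ℂ) p.2.2 *
          (((1 : ℝ) : ℂ) • (1 : Matrix (Fin 4) (Fin 4) ℂ) - euclideanGamma e'.2) p.2.2 q.2.2 * M p.2.1 q.2.1)
      else 0 with hFe
  -- coordinate inclusions of the two `12`-blocks at `z` and `z + μ̂`
  set Bq : Matrix (QuarkIdx L) ((Fin 3 × Fin 4) ⊕ (Fin 3 × Fin 4)) ℂ :=
    Matrix.of fun (p : QuarkIdx L) (s : (Fin 3 × Fin 4) ⊕ (Fin 3 × Fin 4)) =>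
      Sum.elim (fun i : Fin 3 × Fin 4 => if p = (z, i) then (1 : ℂ) else 0)
        (fun i : Fin 3 × Fin 4 =>
          if p = (Literature.MathematicalPhysics.QuantumFieldTheory.Site.shift z μ, i) then (1 : ℂ) else 0) s
    with hBq
  set Cq : Matrix ((Fin 3 × Fin 4) ⊕ (Fin 3 × Fin 4)) (QuarkIdx L) ℂ :=
    Matrix.of fun (s : (Fin 3 × Fin 4) ⊕ (Fin 3 × Fin 4)) (q : QuarkIdx L) =>
      Sum.elim (fun i : Fin 3 × Fin 4 =>
          if q = (Literature.MathematicalPhysics.QuantumFieldTheory.Site.shift z μ, i) then (1 : ℂ) else 0)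
        (fun i : Fin 3 × Fin 4 => if q = (z, i) then (1 : ℂ) else 0) s
    with hCq
  have hρ : ∀ u : SU3, fundamentalRep (Fin 3) u ∈ Matrix.unitaryGroup (Fin 3) ℂ :=
    fun u => fundamentalRep_mem_unitaryGroup u
  -- (i) matrix hop decomposition, edge by edge
  have h1 : ∀ U : GaugeConfig 4 L SU3,
      spinorLift gammaFive * wilsonDirac (fundamentalRep (Fin 3)) U m₀ 1 =
        diagonal (fun p : QuarkIdx L => ((m₀ + 4 * 1 : ℝ) : ℂ) * (![1, 1, -1, -1] : Fin 4 → ℂ) p.2.2) +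
          (∑ e', Fe e' ((U e' : SU3) : Matrix (Fin 3) (Fin 3) ℂ)) +
          (∑ e', Fe e' ((U e' : SU3) : Matrix (Fin 3) (Fin 3) ℂ))ᴴ := by
    intro U
    rw [coareaWegner_gammaFiveWilson_decomp _ hρ, coareaWegner_fwdMatrix_eq_edgeSum]
    simp only [hFe, fundamentalRep_apply]
  -- (ii) isolate the link `e = (z, μ)`
  have h2 : ∀ u : SU3,
      ∑ e', Fe e' ((Function.update W (z, μ) u e' : SU3) : Matrix (Fin 3) (Fin 3) ℂ) =
        Fe (z, μ) (u : Matrix (Fin 3) (Fin 3) ℂ) +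
          ∑ e' ∈ Finset.univ \ {(z, μ)}, Fe e' ((W e' : SU3) : Matrix (Fin 3) (Fin 3) ℂ) :=
    fun u => coareaWegner_edgeSum_update (fun e' (u : SU3) => Fe e' (u : Matrix (Fin 3) (Fin 3) ℂ)) W (z, μ) u
  -- (iii) the one-link term factors through the two `12`-blocks, and is linear
  have hFe' : ∀ M, Fe (z, μ) M = Matrix.of (fun p q : QuarkIdx L =>
      if p.1 = z ∧ q.1 = Literature.MathematicalPhysics.QuantumFieldTheory.Site.shift z μ then
        k M p.2 q.2 else 0) := by
    intro M
    simp only [hFe, hk, of_apply]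
  have h3 : ∀ M, Fe (z, μ) M + (Fe (z, μ) M)ᴴ = Bq * Matrix.fromBlocks (k M) 0 0 (k M)ᴴ * Cq := by
    intro M
    rw [hFe']
    exact coareaWegner_block_factor z (Literature.MathematicalPhysics.QuantumFieldTheory.Site.shift z μ) (k M)
  have hksub : ∀ M M' : Matrix (Fin 3) (Fin 3) ℂ, k (M - M') = k M - k M' := by
    intro M M'
    ext i j
    simp only [hk, of_apply, Matrix.sub_apply]
    ring
  have hFesub : ∀ M M' : Matrix (Fin 3) (Fin 3) ℂ, Fe (z, μ) (M - M') = Fe (z, μ) M - Fe (z, μ) M' := by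
    intro M M'
    rw [hFe', hFe', hFe', hksub]
    ext p q
    simp only [of_apply, Matrix.sub_apply]
    split_ifs <;> ring
  -- the difference
  have hdiff : spinorLift gammaFive * wilsonDirac (fundamentalRep (Fin 3)) (Function.update W (z, μ) v) m₀ 1 -
      spinorLift gammaFive * wilsonDirac (fundamentalRep (Fin 3)) (Function.update W (z, μ) v') m₀ 1 =
      Bq * Matrix.fromBlocks (k ((v : Matrix (Fin 3) (Fin 3) ℂ) - (v' : Matrix (Fin 3) (Fin 3) ℂ))) 0 0
        (k ((v : Matrix (Fin 3) (Fin 3) ℂ) - (v' : Matrix (Fin 3) (Fin 3) ℂ)))ᴴ * Cq := by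
    rw [← h3, hFesub, conjTranspose_sub, h1, h1, h2, h2, conjTranspose_add, conjTranspose_add]
    abel
  rw [hdiff]
  set X : Matrix ((Fin 3 × Fin 4) ⊕ (Fin 3 × Fin 4)) ((Fin 3 × Fin 4) ⊕ (Fin 3 × Fin 4)) ℂ :=
    Matrix.fromBlocks (k ((v : Matrix (Fin 3) (Fin 3) ℂ) - (v' : Matrix (Fin 3) (Fin 3) ℂ))) 0 0
      (k ((v : Matrix (Fin 3) (Fin 3) ℂ) - (v' : Matrix (Fin 3) (Fin 3) ℂ)))ᴴ with hX
  calc (Bq * X * Cq).rank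
      ≤ (Bq * X).rank := Matrix.rank_mul_le_left _ _
    _ ≤ Bq.rank := Matrix.rank_mul_le_left _ _
    _ ≤ Fintype.card ((Fin 3 × Fin 4) ⊕ (Fin 3 × Fin 4)) := Matrix.rank_le_card_width _
    _ = 24 := by simp

/-- **Kernels along a one-link fibre are at most `24`-dimensional off the flat levels.**  If
`H(W[e ↦ v']) − S` is invertible for some value `v'` of the link `e = (z, μ)`, then
`dim ker (H(W[e ↦ v]) − S) ≤ 24` for every value `v`. -/
theorem coareaWegner_oneLink_finrank_ker_le {L : ℕ} [NeZero L] (W : GaugeConfig 4 L SU3) (m₀ : ℝ)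
    (z : TorusSite 4 L) (μ : Fin 4) (v v' : SU3) (S : Matrix (QuarkIdx L) (QuarkIdx L) ℂ)
    (hS : (spinorLift gammaFive * wilsonDirac (fundamentalRep (Fin 3)) (Function.update W (z, μ) v') m₀ 1 -
      S).det ≠ 0) :
    Module.finrank ℂ (LinearMap.ker (spinorLift gammaFive * wilsonDirac (fundamentalRep (Fin 3))
      (Function.update W (z, μ) v) m₀ 1 - S).mulVecLin) ≤ 24 := by
  have hsplit : spinorLift gammaFive * wilsonDirac (fundamentalRep (Fin 3)) (Function.update W (z, μ) v) m₀ 1 -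
      S = (spinorLift gammaFive * wilsonDirac (fundamentalRep (Fin 3)) (Function.update W (z, μ) v') m₀ 1 -
        S) + (spinorLift gammaFive * wilsonDirac (fundamentalRep (Fin 3)) (Function.update W (z, μ) v) m₀ 1 -
          spinorLift gammaFive * wilsonDirac (fundamentalRep (Fin 3)) (Function.update W (z, μ) v') m₀ 1) := by
    abel
  rw [hsplit]
  exact (coareaWegner_finrank_ker_add_le_rank _ _ hS).trans (coareaWegner_oneLink_rank_le W m₀ z μ v v')

/-- **Non-flat levels have multiplicity `≤ 24` along a one-link fibre.**  If the real level `E` is not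
an eigenvalue of `H(W[e ↦ v'])` for some value `v'` of the link `e = (z, μ)` (i.e.
`det (H(W[e ↦ v']) − E) ≠ 0`), then for every value `v` of that link, `E` occurs at most `24` times
among Mathlib's eigenvalues `hH.eigenvalues` of the Hermitian `H(W[e ↦ v]) = Γ₅ D_W(W[e ↦ v], m₀, 1)`
(the spectral data of hypothesis `hspec` of `stub_coareaWegner`).  Combined with the `≤ 48`
distinct crossing parameters per one-link circle (`coareaWegner_oneLinkCircle_crossings`), a non-flat
level is crossed at most `48 · 24` times with multiplicity along every basis circle, uniformly in
`L`. -/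
theorem coareaWegner_oneLink_eigenvalue_mult_le {L : ℕ} [NeZero L] (W : GaugeConfig 4 L SU3) (m₀ : ℝ)
    (z : TorusSite 4 L) (μ : Fin 4) (v v' : SU3) (E : ℝ)
    (hE : (spinorLift gammaFive * wilsonDirac (fundamentalRep (Fin 3)) (Function.update W (z, μ) v') m₀ 1 -
      ((E : ℝ) : ℂ) • (1 : Matrix (QuarkIdx L) (QuarkIdx L) ℂ)).det ≠ 0)
    (hH : (spinorLift gammaFive * wilsonDirac (fundamentalRep (Fin 3))
      (Function.update W (z, μ) v) m₀ 1).IsHermitian) :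
    Fintype.card {j // hH.eigenvalues j = E} ≤ 24 :=
  (coareaWegner_card_eigenvalues_eq_le_finrank_ker hH E).trans
    (coareaWegner_oneLink_finrank_ker_le W m₀ z μ v v' _ hE)

end Summit.QuantumFields.QCD.Cruxes.WegnerEstimate.ResolventCell

end
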